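import Summits.QuantumFields.YangMills.Theorems.BalabanUVNodesN09CentralWindowNondegenerate
import HarnessLib

/-!
# BalabanUVNodes ∕ N09 — ★★★ (F) DISCHARGED: the forward Jacobian laws of the one-variable (0.4) maps on the central `α`-windows, with jointly measurable densities positive
# on the windows, for EVERY environment — hence dag-n09-w6's per-bond inversion data at the record WITHOUT the forward-law hypothesis

Cell `pub-ymgap` (YM-PLAN Track A), width seat `pub-ymgap-dag-n09-w4` g5 (FILE 11 = INTENT-6d, part 3); count-neutral helper of K1⁹ `StabilityBRunRowsAtRecordR13SepCoPHV` =
stmt-QuantumFields-27364 (`--supports`, `--as helper`).  [I] = [Balaban1987RG1].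

WHY.  After dag-n09-w6 g3's nine files the private-coordinate road to the N09 inclusion `hreg` (`…N09HregOfPerBondChartsAtRecord.hreg_of_perBondCharts`) displays per step exactly:
(F) the FORWARD Jacobian law of `g ↦ Ū(U[β(c) ↦ g])(c)` on the central `α`-window `Ωα c U` with a jointly measurable density non-vanishing on the window, (S) the support clause
(dag-n09-w5), (C) the continuity `hgc`.  THIS FILE closes (F): `exists_jacobian_forwardLaws` produces `(jac, hjacm, hjac0, hfwd)` for every coarse bond and every environment, and
`exists_perBondCharts_centralWindow` feeds them to dag-n09-w6's `…N09CentralWindowAtRecord.exists_perBondCharts_of_forwardLaws` at the record.  CONSUMED BY NAME: this seat's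
`…N09CentralWindowForwardLaw` (the law, every `U`), `…N09CentralWindowNondegenerate` (positivity), `…N09CentralWindowChart` (the jointly analytic model), dag-n09-w6's
`exists_perBondCharts_of_forwardLaws`, pub-balaban's `avgFun_update_centralBond_self` ∕ `map_haar_mul_mul` ∕ `coe_avg_expMeanLogSU`, Mathlib's `measurable_fderiv`.

WHAT IS PROVED (0 def, 0 sorry).  §1 `avgFun_update_of_allCentral` · `forwardLaw_of_allCentral` (no off-central index: the map is `g ↦ pre·g·post`, density `1`).  §2 ★★ `measurable_jacobianMeas`
(the density is JOINTLY Borel in `(U, g)`: the chart read is the slice of ONE function on a product normed space, whose Fréchet derivative is Borel with no regularity assumption) ·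
`jacobianMeas_eq_of_mem` (on the window it is the density of `…N09CentralWindowForwardLaw`) · ★ `continuousOn_jacobian_toNNReal` (the density is CONTINUOUS on the window —
dag-n09-w6 g4's ASK for `jd = (jac ∘ ϑ)⁻¹`).  §3 ★★★ `exists_jacobian_forwardLaws_continuousOn` (four clauses: `hjacm`, `hjac0`, `hfwd`, `ContinuousOn (jac c U) (Ωα c U)`) and ★★★ `exists_jacobian_forwardLaws` — `j + 1 ≤ m + K`, `0 ≤ α ≤ 1∕24`, `64·α ≤ δ_N`,
`157·α < L^{−(d−1)}`, `offCard c∕|Idx| + 150·α < 1`: `∃ jac`, jointly measurable per bond, `≠ 0` on `Ωα c U`, with `Haar⌊F(Ωα c U) = F_*(jac c U · Haar⌊Ωα c U)` for every `c, U`.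
§4 ★★★ `exists_perBondCharts_centralWindow` — at the record (`j < K`): the full per-bond inversion bundle `(T, ϑ, jd; …)` of dag-n09-w6's theorem, its forward-law hypothesis DISCHARGED.

HONEST FRAMING.  Count-neutral; classical Lie-group chart calculus ∕ change of variables ∕ Lusin–Souslin BY NAME on the tree's typed (0.4) objects; nothing of Bałaban's estimates
asserted; the hypotheses `64·α ≤ δ_N` and `157·α < L^{−(d−1)}` are explicit smallness conditions on the window radius (the record's (2.9) radius is the caller's); (S) and (C) of the road
remain; `hreg` NOT discharged; N09 NOT discharged; conjunct 1 (Lemma 4) ∕ FLAG №7 untouched; K0⁷ ∕ K1⁹ ∕ K3⁸ NOT closed; counts unmoved; one finite four-torus programme at fixed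
`ε = L^{−K}` — R4 closes the conditional rung `BalabanLadder.UV` only; NOT ℝ⁴ ∕ infinite volume ∕ OS; the Yang–Mills mass gap (Clay) is NOT proved by any of this.
-/

noncomputable section

open scoped Matrix.Norms.L2Operator Topology ContDiff ENNReal NNReal
open Filter Set Function MeasureTheory NormedSpace

namespace Summit.QuantumFields.YangMills.BalabanUVNodes.N09CentralWindowForwardLawAtRecord

open Literature.MathematicalPhysics.QuantumFieldTheory.Balaban1983to89
open Literature.MathematicalPhysics.QuantumFieldTheory.Balaban1983to89.HaarExponentialChart
open Literature.MathematicalPhysics.QuantumFieldTheory.Balaban1983to89.HaarExponentialChart.IsChartRep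
open Literature.MathematicalPhysics.QuantumFieldTheory.Balaban1983to89.BlockAveraging (Small Idx avgFun loopHol instNonemptyIdx)
open Literature.MathematicalPhysics.QuantumFieldTheory.Balaban1983to89.BlockAveragingHaarAC (centralBond pre post openHol IsCentral)
open Literature.MathematicalPhysics.QuantumFieldTheory.Balaban1983to89.BlockAveragingEMLHaarAC (fibreFamily fibreMap FibreSmall fibreGuard offCard
  fibreFamily_of_isCentral fibreMap_of_mem avgFun_update_centralBond_self map_haar_mul_mul coe_avg_expMeanLogSU)
open Literature.MathematicalPhysics.QuantumFieldTheory.Balaban1983to89.ExpMeanLog (eml expMeanLogSU deltaSU)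
open Literature.MathematicalPhysics.QuantumFieldTheory.Balaban1983to89.MatrixLog (mlog mlog_one)
open Literature.MathematicalPhysics.QuantumFieldTheory.Balaban1983to89.Node00
open Literature.MathematicalPhysics.QuantumFieldTheory.Balaban1983to89.T4Continuum (T4Family measurable_holAt)
open Literature.MathematicalPhysics.QuantumLattice (fundamentalRep fundamentalRep_apply)
open Summit.QuantumFields.YangMills.BalabanUVNodes.N09ForwardLawTools
open Summit.QuantumFields.YangMills.BalabanUVNodes.N09CentralWindowChart
open Summit.QuantumFields.YangMills.BalabanUVNodes.N09CentralWindowForwardLaw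
open Summit.QuantumFields.YangMills.BalabanUVNodes.N09CentralWindowNondegenerate
open Summit.QuantumFields.YangMills.BalabanUVNodes.N09CentralWindowAtRecord (exists_perBondCharts_of_forwardLaws)
open Summit.QuantumFields.YangMills.BalabanUVNodes.N09LiftInvariance29AtRecord (succ_le_range_of_lt)

variable {P : Params} {j : ℕ} {N : ℕ} [NeZero N]

/-! ## §1  The all-central case: the window is everything, the map is a bi-translation, the law holds with density `1` -/

section AllCentral

/-- If every index at `c` is central, the (0.4) average of `U[β(c) ↦ g]` at `c` is `pre·g·post` (the correction factor of the constant family `1` is `1`). [cite: Balaban1987RG1, (0.4) p.253] -/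
theorem avgFun_update_of_allCentral (hj : j + 1 ≤ P.m + P.K) (U : GaugeField P j (SU N)) (c : PBond P (j + 1)) (hall : ∀ i : Idx P, IsCentral c i) (g : SU N) :
    avgFun (expMeanLogSU (n := Fin N)) (update U (centralBond c) g) c = pre U c * g * post U c := by
  haveI : Nonempty (Fin N) := ⟨⟨0, Nat.pos_of_ne_zero (NeZero.ne N)⟩⟩
  rw [avgFun_update_centralBond_self hj]
  have hfam : fibreFamily U c (pre U c * g * post U c) = fun _ => 1 := funext fun i => fibreFamily_of_isCentral U c _ i (hall i)
  have hsm : pre U c * g * post U c ∈ fibreGuard (expMeanLogSU (n := Fin N)) U c := by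
    intro i; rw [hfam, GaugeGroup.dist1_one]; exact (expMeanLogSU (n := Fin N)).δ_pos
  rw [fibreMap_of_mem _ U c hsm, hfam]
  have h1 : ((expMeanLogSU (n := Fin N)).avg (fun _ : Idx P => (1 : SU N)) : SU N) = 1 := by
    apply Subtype.ext
    rw [coe_avg_expMeanLogSU _ (fun _ => by rw [GaugeGroup.dist1_one]; exact (expMeanLogSU (n := Fin N)).δ_pos)]
    simp only [OneMemClass.coe_one, mlog_one, Finset.sum_const_zero, smul_zero, exp_zero]
  rw [h1, one_mul]

/-- **THE FORWARD LAW IN THE ALL-CENTRAL CASE** (density `1`, window `= SU(N)`): `Haar⌊F(Ω) = F_*(1·Haar⌊Ω)` for `F(g) = pre·g·post` (Haar is bi-invariant). [cite: Balaban1987RG1, (0.4) p.253 (bookkeeping)] -/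
theorem forwardLaw_of_allCentral (hj : j + 1 ≤ P.m + P.K) (U : GaugeField P j (SU N)) (c : PBond P (j + 1)) (hall : ∀ i : Idx P, IsCentral c i) {α : ℝ} (hα0 : 0 ≤ α) :
    (HaarData.haar : Measure (SU N)).restrict ((fun g : SU N => avgFun (expMeanLogSU (n := Fin N)) (update U (centralBond c) g) c) ''
        {g : SU N | ∀ i : Idx P, dist1 (fibreFamily U c (pre U c * g * post U c) i) ≤ α}) =
      Measure.map (fun g : SU N => avgFun (expMeanLogSU (n := Fin N)) (update U (centralBond c) g) c)
        (((HaarData.haar : Measure (SU N)).restrict {g : SU N | ∀ i : Idx P, dist1 (fibreFamily U c (pre U c * g * post U c) i) ≤ α}).withDensity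
          fun _ => (((1 : ℝ≥0)) : ℝ≥0∞)) := by
  have hΩ : {g : SU N | ∀ i : Idx P, dist1 (fibreFamily U c (pre U c * g * post U c) i) ≤ α} = Set.univ :=
    Set.eq_univ_of_forall fun g i => by
      show dist1 (fibreFamily U c (pre U c * g * post U c) i) ≤ α
      rw [fibreFamily_of_isCentral U c _ i (hall i), GaugeGroup.dist1_one]; exact hα0
  have hF : (fun g : SU N => avgFun (expMeanLogSU (n := Fin N)) (update U (centralBond c) g) c) = fun g => pre U c * g * post U c :=
    funext (avgFun_update_of_allCentral hj U c hall)
  have himg : (fun g : SU N => pre U c * g * post U c) '' Set.univ = Set.univ :=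
    Set.eq_univ_of_forall fun y => ⟨(pre U c)⁻¹ * y * (post U c)⁻¹, Set.mem_univ _, by group⟩
  rw [hΩ, hF, himg, Measure.restrict_univ, ENNReal.coe_one]
  rw [show (fun _ : SU N => (1 : ℝ≥0∞)) = 1 from rfl, withDensity_one, map_haar_mul_mul]

end AllCentral

/-! ## §2  The jointly measurable density and its identification with the density of `…N09CentralWindowForwardLaw` on the window -/

section Density

variable [MeasurableSpace (specialUnitaryLogChart (Fin N)).lie] [BorelSpace (specialUnitaryLogChart (Fin N)).lie]

/-- ★★ **THE DENSITY IS JOINTLY MEASURABLE IN `(U, g)`**: the first and third factors through n09-w2's `measurable_logChart` and the measurability of the (0.4) averaging; the middle factor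
because the chart read is the slice of ONE fixed function `Φ` on the product normed space, whose Fréchet derivative `p ↦ DΦ(p)` is Borel (`measurable_fderiv`) with NO regularity assumption.
[cite: Balaban1987RG1, (0.4) p.253 and (2.10) p.267 (bookkeeping)] -/
theorem measurable_jacobianMeas (c : PBond P (j + 1)) (i₀ : Idx P) :
    Measurable fun p : GaugeField P j (SU N) × SU N => jacDensity (lie_adStable_specialUnitaryGroup (n := Fin N)) ((isChartRep_specialUnitaryGroup (n := Fin N)).logChart ((avgFun (expMeanLogSU (n := Fin N)) (update p.1 (centralBond c) ((pre p.1 c)⁻¹ * openHol p.1 c i₀ * (post p.1 c)⁻¹)) c)⁻¹ * avgFun (expMeanLogSU (n := Fin N)) (update p.1 (centralBond c) p.2) c)) * ENNReal.ofReal |((fderiv ℝ (fun p : ((Idx P → Matrix (Fin N) (Fin N) ℂ) × Matrix (Fin N) (Fin N) ℂ) × (specialUnitaryLogChart (Fin N)).lie => HaarExpChartLocal.proj (specialUnitaryLogChart (Fin N)) (mlog (star ((fun (V : Idx P → Matrix (Fin N) (Fin N) ℂ) (A : Matrix (Fin N) (Fin N) ℂ) => eml (fun i : Idx P => if IsCentral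 c i then (1 : Matrix (Fin N) (Fin N) ℂ) else V i * star A) * A) p.1.1 p.1.2) * (fun (V : Idx P → Matrix (Fin N) (Fin N) ℂ) (A : Matrix (Fin N) (Fin N) ℂ) => eml (fun i : Idx P => if IsCentral c i then (1 : Matrix (Fin N) (Fin N) ℂ) else V i * star A) * A) p.1.1 (p.1.2 * exp ((p.2 : (specialUnitaryLogChart (Fin N)).lie) : Matrix (Fin N) (Fin N) ℂ))))) (((fun i => ((openHol p.1 c i : SU N) : Matrix (Fin N) (Fin N) ℂ)), ((openHol p.1 c i₀ : SU N) : Matrix (Fin N) (Fin N) ℂ)), (isChartRep_specialUnitaryGroup (n := Fin N)).logChart ((openHol p.1 c i₀)⁻¹ * (pre p.1 c * p.2 * post p.1 c)))).comp (ContinuousLinearMap.inr ℝ ((Idx P → Matrix (Fin N) (Fin N) ℂ) × Matrix (Fin N) (Fin N) ℂ) (specialUnitaryLogChart (Fin N)).lie)).det| / jacDensity (lie_adStable_specialUnitaryGroup (n := Fin N)) ((isChartRep_specialUnitaryGroup (n := Fin N)).logChart ((openHol p.1 c i₀)⁻¹ * (pre p.1 c * p.2 * post p.1 c))) := by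
  letI mM : MeasurableSpace (Matrix (Fin N) (Fin N) ℂ) := borel _
  haveI : BorelSpace (Matrix (Fin N) (Fin N) ℂ) := ⟨rfl⟩
  have hupd : Measurable fun p : GaugeField P j (SU N) × SU N => update p.1 (centralBond c) p.2 :=
    (measurable_update' (a := centralBond c)).comp (measurable_fst.prodMk measurable_snd)
  have hAv : Measurable (avgFun (expMeanLogSU (n := Fin N)) : GaugeField P j (SU N) → GaugeField P (j + 1) (SU N)) :=
    BlockAveraging.measurable_avgFun _ ExpMeanLog.measurable_expMeanLogSU_E
  have hA : Measurable fun p : GaugeField P j (SU N) × SU N => avgFun (expMeanLogSU (n := Fin N)) (update p.1 (centralBond c) p.2) c :=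
    (measurable_pi_apply c).comp (hAv.comp hupd)
  have hpre : Measurable fun U : GaugeField P j (SU N) => pre U c := measurable_holAt _
  have hpost : Measurable fun U : GaugeField P j (SU N) => post U c := measurable_holAt _
  have hhol : ∀ i : Idx P, Measurable fun U : GaugeField P j (SU N) => openHol U c i := fun i => measurable_holAt _
  have hb : Measurable fun U : GaugeField P j (SU N) => (pre U c)⁻¹ * openHol U c i₀ * (post U c)⁻¹ := (hpre.inv.mul (hhol i₀)).mul hpost.inv
  have hEb : Measurable fun p : GaugeField P j (SU N) × SU N =>
      avgFun (expMeanLogSU (n := Fin N)) (update p.1 (centralBond c) ((pre p.1 c)⁻¹ * openHol p.1 c i₀ * (post p.1 c)⁻¹)) c :=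
    (measurable_pi_apply c).comp (hAv.comp ((measurable_update' (a := centralBond c)).comp (measurable_fst.prodMk (hb.comp measurable_fst))))
  have hΛ : Measurable (isChartRep_specialUnitaryGroup (n := Fin N)).logChart := (isChartRep_specialUnitaryGroup (n := Fin N)).measurable_logChart
  have hW : Measurable fun p : GaugeField P j (SU N) × SU N => pre p.1 c * p.2 * post p.1 c := ((hpre.comp measurable_fst).mul measurable_snd).mul (hpost.comp measurable_fst)
  have hX : Measurable fun p : GaugeField P j (SU N) × SU N => (isChartRep_specialUnitaryGroup (n := Fin N)).logChart ((openHol p.1 c i₀)⁻¹ * (pre p.1 c * p.2 * post p.1 c)) :=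
    hΛ.comp (((hhol i₀).comp measurable_fst).inv.mul hW)
  have h1 : Measurable fun p : GaugeField P j (SU N) × SU N => jacDensity (lie_adStable_specialUnitaryGroup (n := Fin N)) ((isChartRep_specialUnitaryGroup (n := Fin N)).logChart
      ((avgFun (expMeanLogSU (n := Fin N)) (update p.1 (centralBond c) ((pre p.1 c)⁻¹ * openHol p.1 c i₀ * (post p.1 c)⁻¹)) c)⁻¹ *
        avgFun (expMeanLogSU (n := Fin N)) (update p.1 (centralBond c) p.2) c)) :=
    (continuous_jacDensity (lie_adStable_specialUnitaryGroup (n := Fin N))).measurable.comp (hΛ.comp (hEb.inv.mul hA))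
  have h3 : Measurable fun p : GaugeField P j (SU N) × SU N => jacDensity (lie_adStable_specialUnitaryGroup (n := Fin N)) ((isChartRep_specialUnitaryGroup (n := Fin N)).logChart ((openHol p.1 c i₀)⁻¹ * (pre p.1 c * p.2 * post p.1 c))) :=
    (continuous_jacDensity (lie_adStable_specialUnitaryGroup (n := Fin N))).measurable.comp hX
  -- the middle factor
  have hpar : Measurable fun p : GaugeField P j (SU N) × SU N => (((fun i => ((openHol p.1 c i : SU N) : Matrix (Fin N) (Fin N) ℂ)), ((openHol p.1 c i₀ : SU N) : Matrix (Fin N) (Fin N) ℂ)) : ((Idx P → Matrix (Fin N) (Fin N) ℂ) × Matrix (Fin N) (Fin N) ℂ)) :=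
    (measurable_pi_lambda _ fun i => continuous_subtype_val.measurable.comp ((hhol i).comp measurable_fst)).prodMk
      (continuous_subtype_val.measurable.comp ((hhol i₀).comp measurable_fst))
  have hq : Measurable fun p : GaugeField P j (SU N) × SU N => ((((fun i => ((openHol p.1 c i : SU N) : Matrix (Fin N) (Fin N) ℂ)), ((openHol p.1 c i₀ : SU N) : Matrix (Fin N) (Fin N) ℂ)) : ((Idx P → Matrix (Fin N) (Fin N) ℂ) × Matrix (Fin N) (Fin N) ℂ)), (isChartRep_specialUnitaryGroup (n := Fin N)).logChart ((openHol p.1 c i₀)⁻¹ * (pre p.1 c * p.2 * post p.1 c))) := hpar.prodMk hX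
  have hF := measurable_fderiv ℝ (fun p : ((Idx P → Matrix (Fin N) (Fin N) ℂ) × Matrix (Fin N) (Fin N) ℂ) × (specialUnitaryLogChart (Fin N)).lie => HaarExpChartLocal.proj (specialUnitaryLogChart (Fin N)) (mlog (star ((fun (V : Idx P → Matrix (Fin N) (Fin N) ℂ) (A : Matrix (Fin N) (Fin N) ℂ) => eml (fun i : Idx P => if IsCentral c i then (1 : Matrix (Fin N) (Fin N) ℂ) else V i * star A) * A) p.1.1 p.1.2) * (fun (V : Idx P → Matrix (Fin N) (Fin N) ℂ) (A : Matrix (Fin N) (Fin N) ℂ) => eml (fun i : Idx P => if IsCentral c i then (1 : Matrix (Fin N) (Fin N) ℂ) else V i * star A) * A) p.1.1 (p.1.2 * exp ((p.2 : (specialUnitaryLogChart (Fin N)).lie) : Matrix (Fin N) (Fin N) ℂ)))))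
  have hcont : Continuous fun T : (((Idx P → Matrix (Fin N) (Fin N) ℂ) × Matrix (Fin N) (Fin N) ℂ) × (specialUnitaryLogChart (Fin N)).lie) →L[ℝ] (specialUnitaryLogChart (Fin N)).lie => (T.comp (ContinuousLinearMap.inr ℝ ((Idx P → Matrix (Fin N) (Fin N) ℂ) × Matrix (Fin N) (Fin N) ℂ) (specialUnitaryLogChart (Fin N)).lie)).det :=
    ContinuousLinearMap.continuous_det.comp ((ContinuousLinearMap.compL ℝ (specialUnitaryLogChart (Fin N)).lie (((Idx P → Matrix (Fin N) (Fin N) ℂ) × Matrix (Fin N) (Fin N) ℂ) × (specialUnitaryLogChart (Fin N)).lie) (specialUnitaryLogChart (Fin N)).lie).flip (ContinuousLinearMap.inr ℝ ((Idx P → Matrix (Fin N) (Fin N) ℂ) × Matrix (Fin N) (Fin N) ℂ) (specialUnitaryLogChart (Fin N)).lie)).continuous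
  have h2 : Measurable fun p : GaugeField P j (SU N) × SU N => ENNReal.ofReal |((fderiv ℝ (fun p : ((Idx P → Matrix (Fin N) (Fin N) ℂ) × Matrix (Fin N) (Fin N) ℂ) × (specialUnitaryLogChart (Fin N)).lie => HaarExpChartLocal.proj (specialUnitaryLogChart (Fin N)) (mlog (star ((fun (V : Idx P → Matrix (Fin N) (Fin N) ℂ) (A : Matrix (Fin N) (Fin N) ℂ) => eml (fun i : Idx P => if IsCentral c i then (1 : Matrix (Fin N) (Fin N) ℂ) else V i * star A) * A) p.1.1 p.1.2) * (fun (V : Idx P → Matrix (Fin N) (Fin N) ℂ) (A : Matrix (Fin N) (Fin N) ℂ) => eml (fun i : Idx P => if IsCentral c i then (1 : Matrix (Fin N) (Fin N) ℂ) else V i * star A) * A) p.1.1 (p.1.2 * exp ((p.2 : (specialUnitaryLogChart (Fin N)).lie) : Matrix (Fin N) (Fin N) ℂ))))) (((fun i => ((openHol p.1 c i : SU N) : Matrix (Fin N) (Fin N) ℂ)), ((openHol p.1 c i₀ : SU N) : Matrix (Fin N) (Fin N) ℂ)), (isChartRep_specialUnitaryGroup (n := Fin N)).logChart ((openHol p.1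 c i₀)⁻¹ * (pre p.1 c * p.2 * post p.1 c)))).comp
      (ContinuousLinearMap.inr ℝ ((Idx P → Matrix (Fin N) (Fin N) ℂ) × Matrix (Fin N) (Fin N) ℂ) (specialUnitaryLogChart (Fin N)).lie)).det| :=
    ENNReal.measurable_ofReal.comp (continuous_abs.measurable.comp (hcont.measurable.comp (hF.comp hq)))
  exact (h1.mul h2).div h3

omit [MeasurableSpace (specialUnitaryLogChart (Fin N)).lie] [BorelSpace (specialUnitaryLogChart (Fin N)).lie] in
/-- **On the window the measurable density IS the density of the forward law** (`Ū(U[β ↦ g])(c) = E(pre·g·post)`, `Ū(U[β ↦ pre⁻¹bpost⁻¹])(c) = E(b)`, `Φ(par, Λ(b⁻¹W)) = Λ(E(b)⁻¹E(W))`).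
[cite: Balaban1987RG1, (0.4) p.253 and (2.10) p.267 (bookkeeping)] -/
theorem jacobianMeas_eq_of_mem (hj : j + 1 ≤ P.m + P.K) (U : GaugeField P j (SU N)) (c : PBond P (j + 1)) {α : ℝ} (hα0 : 0 ≤ α) (hα64 : 64 * α ≤ deltaSU (Fin N))
    {i₀ : Idx P} (hi₀ : ¬ IsCentral c i₀)
    (EE : (Idx P → Matrix (Fin N) (Fin N) ℂ) → Matrix (Fin N) (Fin N) ℂ → Matrix (Fin N) (Fin N) ℂ)
    (hEE : ∀ V A, EE V A = eml (fun i : Idx P => if IsCentral c i then (1 : Matrix (Fin N) (Fin N) ℂ) else V i * star A) * A)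
    (Φ : ((Idx P → Matrix (Fin N) (Fin N) ℂ) × Matrix (Fin N) (Fin N) ℂ) × (specialUnitaryLogChart (Fin N)).lie → (specialUnitaryLogChart (Fin N)).lie)
    (hΦ : ∀ p, Φ p = HaarExpChartLocal.proj (specialUnitaryLogChart (Fin N))
      (mlog (star (EE p.1.1 p.1.2) * EE p.1.1 (p.1.2 * exp ((p.2 : (specialUnitaryLogChart (Fin N)).lie) : Matrix (Fin N) (Fin N) ℂ)))))
    {g : SU N} (hg : ∀ i : Idx P, dist1 (fibreFamily U c (pre U c * g * post U c) i) ≤ α) :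
    jacDensity (lie_adStable_specialUnitaryGroup (n := Fin N)) ((isChartRep_specialUnitaryGroup (n := Fin N)).logChart ((avgFun (expMeanLogSU (n := Fin N)) (update U (centralBond c) ((pre U c)⁻¹ * openHol U c i₀ * (post U c)⁻¹)) c)⁻¹ * avgFun (expMeanLogSU (n := Fin N)) (update U (centralBond c) g) c)) * ENNReal.ofReal |((fderiv ℝ Φ (((fun i => ((openHol U c i : SU N) : Matrix (Fin N) (Fin N) ℂ)), ((openHol U c i₀ : SU N) : Matrix (Fin N) (Fin N) ℂ)), (isChartRep_specialUnitaryGroup (n := Fin N)).logChart ((openHol U c i₀)⁻¹ * (pre U c * g * post U c)))).comp (ContinuousLinearMap.inr ℝ ((Idx P → Matrix (Fin N) (Fin N) ℂ) × Matrix (Fin N) (Fin N) ℂ) (specialUnitaryLogChart (Fin N)).lie)).det| / jacDensity (lie_adStable_specialUnitaryGroup (n := Fin N)) ((isChartRep_specialUnitaryGroup (n := Fin N)).logChart ((openHol U c i₀)⁻¹ * (pre U c * g * post U c))) =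
    jacDensity (lie_adStable_specialUnitaryGroup (n := Fin N)) (Φ (((fun i => ((openHol U c i : SU N) : Matrix (Fin N) (Fin N) ℂ)), ((openHol U c i₀ : SU N) : Matrix (Fin N) (Fin N) ℂ)), (isChartRep_specialUnitaryGroup (n := Fin N)).logChart ((openHol U c i₀)⁻¹ * (pre U c * g * post U c)))) * ENNReal.ofReal |((fderiv ℝ Φ (((fun i => ((openHol U c i : SU N) : Matrix (Fin N) (Fin N) ℂ)), ((openHol U c i₀ : SU N) : Matrix (Fin N) (Fin N) ℂ)), (isChartRep_specialUnitaryGroup (n := Fin N)).logChart ((openHol U c i₀)⁻¹ * (pre U c * g * post U c)))).comp (ContinuousLinearMap.inr ℝ ((Idx P → Matrix (Fin N) (Fin N) ℂ) × Matrix (Fin N) (Fin N) ℂ) (specialUnitaryLogChart (Fin N)).lie)).det| / jacDensity (lie_adStable_specialUnitaryGroup (n := Fin N)) ((isChartRep_specialUnitaryGroup (n := Fin N)).logChart ((openHol U c i₀)⁻¹ * (pre U c * g * post U c))) := by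
  have h1 : avgFun (expMeanLogSU (n := Fin N)) (update U (centralBond c) g) c = fibreMap (expMeanLogSU (n := Fin N)) U c (pre U c * g * post U c) :=
    avgFun_update_centralBond_self hj _ U c g
  have h2 : avgFun (expMeanLogSU (n := Fin N)) (update U (centralBond c) ((pre U c)⁻¹ * openHol U c i₀ * (post U c)⁻¹)) c =
      fibreMap (expMeanLogSU (n := Fin N)) U c (openHol U c i₀) := by
    rw [avgFun_update_centralBond_self hj]; congr 1; group
  rw [h1, h2, modelChart_at_logChart_eq U c hα0 hα64 hi₀ EE hEE Φ hΦ hg]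

omit [MeasurableSpace (specialUnitaryLogChart (Fin N)).lie] [BorelSpace (specialUnitaryLogChart (Fin N)).lie] in
/-- ★ **THE DENSITY IS CONTINUOUS ON THE WINDOW** (dag-n09-w6 g4's ASK I.37573, for their `jd = (jac ∘ ϑ)⁻¹` continuity): on `Ωα c U` the density of the forward law, read as a real number
`|det jac(Φ(par,X))|·|det D_XΦ(par,X)| ∕ |det jac(X)|`, `X = Λ(b⁻¹·pre·g·post)`, is continuous — `Λ` is continuous on the chart domain (n09-w2's `continuousOn_logChart`), `Φ` is `C^ω` jointly
(`contDiffAt_modelChart`, hence `p ↦ DΦ(p)` continuous at window points), `det` is continuous, and the denominator does not vanish. [cite: Balaban1987RG1, (2.10) p.267; Helgason2000, Ch. I §1 Thm. 1.14 (12)-(13) p. 96] -/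
theorem continuousOn_jacobian_toNNReal (U : GaugeField P j (SU N)) (c : PBond P (j + 1)) {α : ℝ} (hα0 : 0 ≤ α) (hα64 : 64 * α ≤ deltaSU (Fin N))
    {i₀ : Idx P} (hi₀ : ¬ IsCentral c i₀)
    (EE : (Idx P → Matrix (Fin N) (Fin N) ℂ) → Matrix (Fin N) (Fin N) ℂ → Matrix (Fin N) (Fin N) ℂ)
    (hEE : ∀ V A, EE V A = eml (fun i : Idx P => if IsCentral c i then (1 : Matrix (Fin N) (Fin N) ℂ) else V i * star A) * A)
    (Φ : ((Idx P → Matrix (Fin N) (Fin N) ℂ) × Matrix (Fin N) (Fin N) ℂ) × (specialUnitaryLogChart (Fin N)).lie → (specialUnitaryLogChart (Fin N)).lie)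
    (hΦ : ∀ p, Φ p = HaarExpChartLocal.proj (specialUnitaryLogChart (Fin N))
      (mlog (star (EE p.1.1 p.1.2) * EE p.1.1 (p.1.2 * exp ((p.2 : (specialUnitaryLogChart (Fin N)).lie) : Matrix (Fin N) (Fin N) ℂ))))) :
    ContinuousOn (fun g : SU N => ENNReal.toNNReal (jacDensity (lie_adStable_specialUnitaryGroup (n := Fin N)) (Φ (((fun i => ((openHol U c i : SU N) : Matrix (Fin N) (Fin N) ℂ)), ((openHol U c i₀ : SU N) : Matrix (Fin N) (Fin N) ℂ)), (isChartRep_specialUnitaryGroup (n := Fin N)).logChart ((openHol U c i₀)⁻¹ * (pre U c * g * post U c)))) * ENNReal.ofReal |((fderiv ℝ Φ (((fun i => ((openHol U c i : SU N) : Matrix (Fin N) (Fin N) ℂ)), ((openHol U c i₀ : SU N) : Matrix (Fin N) (Fin N) ℂ)), (isChartRep_specialUnitaryGroup (n := Fin N)).logChart ((openHol U c i₀)⁻¹ * (pre U c * g * post U c)))).comp (ContinuousLinearMap.inr ℝ ((Idx P → Matrix (Fin N) (Fin N) ℂ) × Matrix (Fin N) (Fin N) ℂ) (specialUnitaryLogChart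 (Fin N)).lie)).det| / jacDensity (lie_adStable_specialUnitaryGroup (n := Fin N)) ((isChartRep_specialUnitaryGroup (n := Fin N)).logChart ((openHol U c i₀)⁻¹ * (pre U c * g * post U c)))))
      {g : SU N | ∀ i : Idx P, dist1 (fibreFamily U c (pre U c * g * post U c) i) ≤ α} := by
  obtain ⟨h19r, h38s, h19half, h2αδ, h19one⟩ := radii_of_le_deltaSU (N := N) hα0 hα64
  have hαδ : α < deltaSU (Fin N) := by linarith
  have hcont : Continuous fun T : (((Idx P → Matrix (Fin N) (Fin N) ℂ) × Matrix (Fin N) (Fin N) ℂ) × (specialUnitaryLogChart (Fin N)).lie) →L[ℝ] (specialUnitaryLogChart (Fin N)).lie => (T.comp (ContinuousLinearMap.inr ℝ ((Idx P → Matrix (Fin N) (Fin N) ℂ) × Matrix (Fin N) (Fin N) ℂ) (specialUnitaryLogChart (Fin N)).lie)).det :=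
    ContinuousLinearMap.continuous_det.comp ((ContinuousLinearMap.compL ℝ (specialUnitaryLogChart (Fin N)).lie (((Idx P → Matrix (Fin N) (Fin N) ℂ) × Matrix (Fin N) (Fin N) ℂ) × (specialUnitaryLogChart (Fin N)).lie) (specialUnitaryLogChart (Fin N)).lie).flip (ContinuousLinearMap.inr ℝ ((Idx P → Matrix (Fin N) (Fin N) ℂ) × Matrix (Fin N) (Fin N) ℂ) (specialUnitaryLogChart (Fin N)).lie)).continuous
  -- facts at a window point
  have hwin : ∀ {g : SU N}, (∀ i : Idx P, dist1 (fibreFamily U c (pre U c * g * post U c) i) ≤ α) →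
      ‖fundamentalRep (Fin N) ((openHol U c i₀)⁻¹ * (pre U c * g * post U c)) - 1‖ < innerRadius (specialUnitaryLogChart (Fin N)) := by
    intro g hg; rw [fundamentalRep_apply, norm_coe_inv_mul_sub_one, norm_sub_rev]
    exact (norm_openHol_sub_le_of_mem U c hg hi₀).trans_lt (by linarith)
  have hX : ContinuousOn (fun g : SU N => (isChartRep_specialUnitaryGroup (n := Fin N)).logChart ((openHol U c i₀)⁻¹ * (pre U c * g * post U c)))
      {g : SU N | ∀ i : Idx P, dist1 (fibreFamily U c (pre U c * g * post U c) i) ≤ α} :=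
    (isChartRep_specialUnitaryGroup (n := Fin N)).continuousOn_logChart.comp ((continuous_const.mul ((continuous_const.mul continuous_id).mul continuous_const)).continuousOn) fun g hg => hwin hg
  have hXlt : ∀ {g : SU N}, (∀ i : Idx P, dist1 (fibreFamily U c (pre U c * g * post U c) i) ≤ α) →
      ‖(isChartRep_specialUnitaryGroup (n := Fin N)).logChart ((openHol U c i₀)⁻¹ * (pre U c * g * post U c))‖ < chartRadius (specialUnitaryLogChart (Fin N)) := by
    intro g hg
    have hk : (openHol U c i₀)⁻¹ * (pre U c * g * post U c) ∈ (isChartRep_specialUnitaryGroup (n := Fin N)).window (chartRadius (specialUnitaryLogChart (Fin N))) := by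
      refine mem_window_of_norm_sub_one_le (t := α) ?_ (by linarith) (by linarith) (by linarith)
      rw [norm_coe_inv_mul_sub_one, norm_sub_rev]; exact norm_openHol_sub_le_of_mem U c hg hi₀
    exact mem_ball_zero_iff.1 ((isChartRep_specialUnitaryGroup (n := Fin N)).logChart_mem_ball le_rfl hk)
  have hΦd : ∀ {g : SU N}, (∀ i : Idx P, dist1 (fibreFamily U c (pre U c * g * post U c) i) ≤ α) →
      ContDiffAt ℝ ⊤ Φ (((fun i => ((openHol U c i : SU N) : Matrix (Fin N) (Fin N) ℂ)), ((openHol U c i₀ : SU N) : Matrix (Fin N) (Fin N) ℂ)), (isChartRep_specialUnitaryGroup (n := Fin N)).logChart ((openHol U c i₀)⁻¹ * (pre U c * g * post U c))) := by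
    intro g hg
    have hWs : FibreSmall (expMeanLogSU (n := Fin N)) U c (pre U c * g * post U c) := fibreSmall_of_mem_window U c hαδ hg
    have hbs : FibreSmall (expMeanLogSU (n := Fin N)) U c (openHol U c i₀) := fibreSmall_openHol_of_mem_window U c hα0 h2αδ hg hi₀
    have hbΘ : openHol U c i₀ * (isChartRep_specialUnitaryGroup (n := Fin N)).expChart ((isChartRep_specialUnitaryGroup (n := Fin N)).logChart ((openHol U c i₀)⁻¹ * (pre U c * g * post U c))) = pre U c * g * post U c := by
      rw [(isChartRep_specialUnitaryGroup (n := Fin N)).expChart_logChart (hwin hg), mul_inv_cancel_left]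
    have hcoe : ((openHol U c i₀ : SU N) : Matrix (Fin N) (Fin N) ℂ) * exp ((((isChartRep_specialUnitaryGroup (n := Fin N)).logChart ((openHol U c i₀)⁻¹ * (pre U c * g * post U c)) : (specialUnitaryLogChart (Fin N)).lie) : (specialUnitaryLogChart (Fin N)).lie) : Matrix (Fin N) (Fin N) ℂ) =
        ((pre U c * g * post U c : SU N) : Matrix (Fin N) (Fin N) ℂ) := by
      rw [← coe_expChart_SU, ← Submonoid.coe_mul, hbΘ]
    refine contDiffAt_modelChart c EE hEE Φ hΦ ?_ ?_ ?_
    · intro i hi; rw [norm_coe_mul_star_sub_one]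
      exact (norm_openHol_sub_openHol_le U c hg hi hi₀).trans_lt (by linarith)
    · intro i hi; rw [hcoe, norm_coe_mul_star_sub_one]; exact (norm_openHol_sub_le_of_mem U c hg hi).trans_lt (by linarith)
    · have hXs : FibreSmall (expMeanLogSU (n := Fin N)) U c (openHol U c i₀ * (isChartRep_specialUnitaryGroup (n := Fin N)).expChart ((isChartRep_specialUnitaryGroup (n := Fin N)).logChart ((openHol U c i₀)⁻¹ * (pre U c * g * post U c)))) := by
        rw [hbΘ]; exact hWs
      rw [star_modelE_mul_modelE_eq_coe U c EE hEE hbs hXs, hbΘ]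
      exact (norm_coe_fibreMap_inv_mul_sub_one_le U c hα0 (by linarith) h2αδ hg hi₀).trans_lt h19one
  -- the real-valued density is continuous on the window
  have hR : ContinuousOn (fun g : SU N =>
      |LinearMap.det (B13HaarSigmaJacobian.jac (lie_adStable_specialUnitaryGroup (n := Fin N)) (Φ (((fun i => ((openHol U c i : SU N) : Matrix (Fin N) (Fin N) ℂ)), ((openHol U c i₀ : SU N) : Matrix (Fin N) (Fin N) ℂ)), (isChartRep_specialUnitaryGroup (n := Fin N)).logChart ((openHol U c i₀)⁻¹ * (pre U c * g * post U c)))) : (specialUnitaryLogChart (Fin N)).lie →ₗ[ℝ] (specialUnitaryLogChart (Fin N)).lie)| *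
        |((fderiv ℝ Φ (((fun i => ((openHol U c i : SU N) : Matrix (Fin N) (Fin N) ℂ)), ((openHol U c i₀ : SU N) : Matrix (Fin N) (Fin N) ℂ)), (isChartRep_specialUnitaryGroup (n := Fin N)).logChart ((openHol U c i₀)⁻¹ * (pre U c * g * post U c)))).comp (ContinuousLinearMap.inr ℝ ((Idx P → Matrix (Fin N) (Fin N) ℂ) × Matrix (Fin N) (Fin N) ℂ) (specialUnitaryLogChart (Fin N)).lie)).det| /
        |LinearMap.det (B13HaarSigmaJacobian.jac (lie_adStable_specialUnitaryGroup (n := Fin N)) ((isChartRep_specialUnitaryGroup (n := Fin N)).logChart ((openHol U c i₀)⁻¹ * (pre U c * g * post U c))) : (specialUnitaryLogChart (Fin N)).lie →ₗ[ℝ] (specialUnitaryLogChart (Fin N)).lie)|)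
      {g : SU N | ∀ i : Idx P, dist1 (fibreFamily U c (pre U c * g * post U c) i) ≤ α} := by
    intro g hg
    have hq : ContinuousWithinAt (fun g : SU N => ((((fun i => ((openHol U c i : SU N) : Matrix (Fin N) (Fin N) ℂ)), ((openHol U c i₀ : SU N) : Matrix (Fin N) (Fin N) ℂ)) : ((Idx P → Matrix (Fin N) (Fin N) ℂ) × Matrix (Fin N) (Fin N) ℂ)), (isChartRep_specialUnitaryGroup (n := Fin N)).logChart ((openHol U c i₀)⁻¹ * (pre U c * g * post U c))))
        {g : SU N | ∀ i : Idx P, dist1 (fibreFamily U c (pre U c * g * post U c) i) ≤ α} g := continuousWithinAt_const.prodMk (hX g hg)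
    have hΦg : ContinuousWithinAt (fun g : SU N => Φ (((fun i => ((openHol U c i : SU N) : Matrix (Fin N) (Fin N) ℂ)), ((openHol U c i₀ : SU N) : Matrix (Fin N) (Fin N) ℂ)), (isChartRep_specialUnitaryGroup (n := Fin N)).logChart ((openHol U c i₀)⁻¹ * (pre U c * g * post U c)))) {g : SU N | ∀ i : Idx P, dist1 (fibreFamily U c (pre U c * g * post U c) i) ≤ α} g :=
      ContinuousAt.comp_continuousWithinAt (g := Φ) (f := fun g : SU N => ((((fun i => ((openHol U c i : SU N) : Matrix (Fin N) (Fin N) ℂ)), ((openHol U c i₀ : SU N) : Matrix (Fin N) (Fin N) ℂ)) : ((Idx P → Matrix (Fin N) (Fin N) ℂ) × Matrix (Fin N) (Fin N) ℂ)), (isChartRep_specialUnitaryGroup (n := Fin N)).logChart ((openHol U c i₀)⁻¹ * (pre U c * g * post U c)))) (hΦd hg).continuousAt hq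
    have hDg : ContinuousWithinAt (fun g : SU N => fderiv ℝ Φ (((fun i => ((openHol U c i : SU N) : Matrix (Fin N) (Fin N) ℂ)), ((openHol U c i₀ : SU N) : Matrix (Fin N) (Fin N) ℂ)), (isChartRep_specialUnitaryGroup (n := Fin N)).logChart ((openHol U c i₀)⁻¹ * (pre U c * g * post U c)))) {g : SU N | ∀ i : Idx P, dist1 (fibreFamily U c (pre U c * g * post U c) i) ≤ α} g :=
      ContinuousAt.comp_continuousWithinAt (g := fderiv ℝ Φ) (f := fun g : SU N => ((((fun i => ((openHol U c i : SU N) : Matrix (Fin N) (Fin N) ℂ)), ((openHol U c i₀ : SU N) : Matrix (Fin N) (Fin N) ℂ)) : ((Idx P → Matrix (Fin N) (Fin N) ℂ) × Matrix (Fin N) (Fin N) ℂ)), (isChartRep_specialUnitaryGroup (n := Fin N)).logChart ((openHol U c i₀)⁻¹ * (pre U c * g * post U c)))) ((hΦd hg).continuousAt_fderiv (by simp)) hq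
    have ha := ContinuousAt.comp_continuousWithinAt (g := fun x : (specialUnitaryLogChart (Fin N)).lie => |LinearMap.det (B13HaarSigmaJacobian.jac (lie_adStable_specialUnitaryGroup (n := Fin N)) x : (specialUnitaryLogChart (Fin N)).lie →ₗ[ℝ] (specialUnitaryLogChart (Fin N)).lie)|)
      (f := fun g : SU N => Φ (((fun i => ((openHol U c i : SU N) : Matrix (Fin N) (Fin N) ℂ)), ((openHol U c i₀ : SU N) : Matrix (Fin N) (Fin N) ℂ)), (isChartRep_specialUnitaryGroup (n := Fin N)).logChart ((openHol U c i₀)⁻¹ * (pre U c * g * post U c)))) ((continuous_abs.comp (continuous_det_jac (lie_adStable_specialUnitaryGroup (n := Fin N)))).continuousAt) hΦg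
    have hd := ContinuousAt.comp_continuousWithinAt (g := fun T : (((Idx P → Matrix (Fin N) (Fin N) ℂ) × Matrix (Fin N) (Fin N) ℂ) × (specialUnitaryLogChart (Fin N)).lie) →L[ℝ] (specialUnitaryLogChart (Fin N)).lie => |(T.comp (ContinuousLinearMap.inr ℝ ((Idx P → Matrix (Fin N) (Fin N) ℂ) × Matrix (Fin N) (Fin N) ℂ) (specialUnitaryLogChart (Fin N)).lie)).det|)
      (f := fun g : SU N => fderiv ℝ Φ (((fun i => ((openHol U c i : SU N) : Matrix (Fin N) (Fin N) ℂ)), ((openHol U c i₀ : SU N) : Matrix (Fin N) (Fin N) ℂ)), (isChartRep_specialUnitaryGroup (n := Fin N)).logChart ((openHol U c i₀)⁻¹ * (pre U c * g * post U c)))) ((continuous_abs.comp hcont).continuousAt) hDg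
    have he := ContinuousAt.comp_continuousWithinAt (g := fun x : (specialUnitaryLogChart (Fin N)).lie => |LinearMap.det (B13HaarSigmaJacobian.jac (lie_adStable_specialUnitaryGroup (n := Fin N)) x : (specialUnitaryLogChart (Fin N)).lie →ₗ[ℝ] (specialUnitaryLogChart (Fin N)).lie)|)
      (f := fun g : SU N => (isChartRep_specialUnitaryGroup (n := Fin N)).logChart ((openHol U c i₀)⁻¹ * (pre U c * g * post U c))) ((continuous_abs.comp (continuous_det_jac (lie_adStable_specialUnitaryGroup (n := Fin N)))).continuousAt) (hX g hg)
    have hne : |LinearMap.det (B13HaarSigmaJacobian.jac (lie_adStable_specialUnitaryGroup (n := Fin N)) ((isChartRep_specialUnitaryGroup (n := Fin N)).logChart ((openHol U c i₀)⁻¹ * (pre U c * g * post U c))) : (specialUnitaryLogChart (Fin N)).lie →ₗ[ℝ] (specialUnitaryLogChart (Fin N)).lie)| ≠ 0 :=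
      abs_ne_zero.2 (det_jac_ne_zero_of_norm_le_half (lie_adStable_specialUnitaryGroup (n := Fin N)) (((hXlt hg).le.trans chartRadius_le_innerRadius).trans innerRadius_le_half))
    exact (ha.mul hd).div he hne
  refine (continuous_real_toNNReal.comp_continuousOn hR).congr fun g hg => ?_
  have hpos : 0 < |LinearMap.det (B13HaarSigmaJacobian.jac (lie_adStable_specialUnitaryGroup (n := Fin N)) ((isChartRep_specialUnitaryGroup (n := Fin N)).logChart ((openHol U c i₀)⁻¹ * (pre U c * g * post U c))) : (specialUnitaryLogChart (Fin N)).lie →ₗ[ℝ] (specialUnitaryLogChart (Fin N)).lie)| :=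
    abs_pos.2 (det_jac_ne_zero_of_norm_le_half (lie_adStable_specialUnitaryGroup (n := Fin N)) (((hXlt hg).le.trans chartRadius_le_innerRadius).trans innerRadius_le_half))
  show ENNReal.toNNReal _ = Real.toNNReal _
  rw [jacDensity_def, jacDensity_def, ← ENNReal.ofReal_mul (abs_nonneg _), ← ENNReal.ofReal_div_of_pos hpos, ENNReal.ofReal, ENNReal.toNNReal_coe]

end Density

/-! ## §3  ★★★ (F) FOR EVERY ENVIRONMENT: jointly measurable positive densities and the forward laws on the central `α`-windows -/

section Package

/-- ★★★ **(F) DISCHARGED, WITH CONTINUITY ON THE WINDOWS — THE FORWARD JACOBIAN LAWS OF THE ONE-VARIABLE (0.4) MAPS ON THE CENTRAL `α`-WINDOWS, WITH JOINTLY MEASURABLE DENSITIES POSITIVE ON THE WINDOWS, FOR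
EVERY coarse bond `c` and EVERY environment `U`** (`j + 1 ≤ m + K`, `0 ≤ α ≤ 1∕24`, `64·α ≤ δ_N`, `157·α < L^{−(d−1)}`, `offCard c∕|Idx| + 150·α < 1`): exactly the inputs `(jac, hjacm, hjac0, hfwd)` of
dag-n09-w6's `…N09CentralWindowAtRecord.exists_perBondCharts_of_forwardLaws` ∕ `…N09PerBondChartsOfInjectivityWindows.exists_perBondCharts_of_injectivityWindows`.  At a bond with an
off-central index the density is the chart Jacobian of `…N09CentralWindowForwardLaw` (one chart at `V_{i₀}`), measurable by §2 and positive by `…N09CentralWindowNondegenerate`; at an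
all-central bond the map is a bi-translation and the density is `1` (§1); the fourth clause (dag-n09-w6 g4's ASK) is `continuousOn_jacobian_toNNReal`. [cite: Balaban1987RG1, (0.4) p.253 and (2.10) p.267; Helgason2000, Ch. I §1 Thm. 1.14 (12)-(13) p. 96] -/
theorem exists_jacobian_forwardLaws_continuousOn (hj : j + 1 ≤ P.m + P.K) {α : ℝ} (hα0 : 0 ≤ α) (hα24 : α ≤ 1 / 24) (hα64 : 64 * α ≤ deltaSU (Fin N))
    (hαL : 157 * α < ((P.L : ℝ) ^ (P.d - 1))⁻¹) (hgap : ∀ c : PBond P (j + 1), (offCard c : ℝ) / (Fintype.card (Idx P) : ℝ) + 150 * α < 1) :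
    ∃ jac : PBond P (j + 1) → GaugeField P j (SU N) → SU N → ℝ≥0,
      (∀ c, Measurable fun p : GaugeField P j (SU N) × SU N => jac c p.1 p.2) ∧
      (∀ c U g, (∀ i : Idx P, dist1 (fibreFamily U c (pre U c * g * post U c) i) ≤ α) → jac c U g ≠ 0) ∧
      (∀ c U, (HaarData.haar : Measure (SU N)).restrict ((fun g : SU N => avgFun (expMeanLogSU (n := Fin N)) (update U (centralBond c) g) c) '' {g : SU N | ∀ i : Idx P, dist1 (fibreFamily U c (pre U c * g * post U c) i) ≤ α}) =
        Measure.map (fun g : SU N => avgFun (expMeanLogSU (n := Fin N)) (update U (centralBond c) g) c) (((HaarData.haar : Measure (SU N)).restrict {g : SU N | ∀ i : Idx P, dist1 (fibreFamily U c (pre U c * g * post U c) i) ≤ α}).withDensity fun g => (jac c U g : ℝ≥0∞))) ∧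
      (∀ c U, ContinuousOn (jac c U) {g : SU N | ∀ i : Idx P, dist1 (fibreFamily U c (pre U c * g * post U c) i) ≤ α}) := by
  classical
  letI : MeasurableSpace (specialUnitaryLogChart (Fin N)).lie := borel _
  haveI : BorelSpace (specialUnitaryLogChart (Fin N)).lie := ⟨rfl⟩
  obtain ⟨jac, hjac⟩ : ∃ jac : PBond P (j + 1) → GaugeField P j (SU N) → SU N → ℝ≥0, ∀ c, jac c =
      (if hc : (∃ i : Idx P, ¬ IsCentral c i) then
      (fun U g => ENNReal.toNNReal (jacDensity (lie_adStable_specialUnitaryGroup (n := Fin N)) ((isChartRep_specialUnitaryGroup (n := Fin N)).logChart ((avgFun (expMeanLogSU (n := Fin N)) (update U (centralBond c) ((pre U c)⁻¹ * openHol U c hc.choose * (post U c)⁻¹)) c)⁻¹ * avgFun (expMeanLogSU (n := Fin N)) (update U (centralBond c) g) c)) * ENNReal.ofReal |((fderiv ℝ (fun p : ((Idx P → Matrix (Fin N) (Fin N) ℂ) × Matrix (Fin N) (Fin N) ℂ) × (specialUnitaryLogChart (Fin N)).lie => HaarExpChartLocal.proj (specialUnitaryLogChart (Fin N)) (mlog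 (star ((fun (V : Idx P → Matrix (Fin N) (Fin N) ℂ) (A : Matrix (Fin N) (Fin N) ℂ) => eml (fun i : Idx P => if IsCentral c i then (1 : Matrix (Fin N) (Fin N) ℂ) else V i * star A) * A) p.1.1 p.1.2) * (fun (V : Idx P → Matrix (Fin N) (Fin N) ℂ) (A : Matrix (Fin N) (Fin N) ℂ) => eml (fun i : Idx P => if IsCentral c i then (1 : Matrix (Fin N) (Fin N) ℂ) else V i * star A) * A) p.1.1 (p.1.2 * exp ((p.2 : (specialUnitaryLogChart (Fin N)).lie) : Matrix (Fin N) (Fin N) ℂ))))) (((fun i => ((openHol U c i : SU N) : Matrix (Fin N) (Fin N) ℂ)), ((openHol U c hc.choose : SU N) : Matrix (Fin N) (Fin N) ℂ)), (isChartRep_specialUnitaryGroup (n := Fin N)).logChart ((openHol U c hc.choose)⁻¹ * (pre U c * g * post U c)))).comp (ContinuousLinearMap.inr ℝ ((Idx P → Matrix (Fin N) (Fin N) ℂ) × Matrix (Fin N) (Fin N) ℂ) (specialUnitaryLogChart (Fin N)).lie)).det| / jacDensity (lie_adStable_specialUnitaryGroup (n := Fin N)) ((isChartRep_specialUnitaryGroup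 (n := Fin N)).logChart ((openHol U c hc.choose)⁻¹ * (pre U c * g * post U c)))))
    else fun _ _ => 1) := ⟨_, fun c => rfl⟩
  refine ⟨jac, ?_, ?_, ?_, ?_⟩
  · intro c
    by_cases hc : ∃ i : Idx P, ¬ IsCentral c i
    · rw [hjac c, dif_pos hc]
      exact (measurable_jacobianMeas (N := N) c hc.choose).ennreal_toNNReal
    · rw [hjac c, dif_neg hc]; exact measurable_const
  · intro c U g hg
    by_cases hc : ∃ i : Idx P, ¬ IsCentral c i
    · rw [hjac c, dif_pos hc]
      have hne := jacobian_ne_zero_and_ne_top_of_mem hj U c hα0 hα24 hα64 hαL hc.choose_spec (fun (V : Idx P → Matrix (Fin N) (Fin N) ℂ) (A : Matrix (Fin N) (Fin N) ℂ) => eml (fun i : Idx P => if IsCentral c i then (1 : Matrix (Fin N) (Fin N) ℂ) else V i * star A) * A) (fun _ _ => rfl) (fun p : ((Idx P → Matrix (Fin N) (Fin N) ℂ) × Matrix (Fin N) (Fin N) ℂ) × (specialUnitaryLogChart (Fin N)).lie => HaarExpChartLocal.proj (specialUnitaryLogChart (Fin N)) (mlog (star ((fun (V : Idx P → Matrix (Fin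 N) (Fin N) ℂ) (A : Matrix (Fin N) (Fin N) ℂ) => eml (fun i : Idx P => if IsCentral c i then (1 : Matrix (Fin N) (Fin N) ℂ) else V i * star A) * A) p.1.1 p.1.2) * (fun (V : Idx P → Matrix (Fin N) (Fin N) ℂ) (A : Matrix (Fin N) (Fin N) ℂ) => eml (fun i : Idx P => if IsCentral c i then (1 : Matrix (Fin N) (Fin N) ℂ) else V i * star A) * A) p.1.1 (p.1.2 * exp ((p.2 : (specialUnitaryLogChart (Fin N)).lie) : Matrix (Fin N) (Fin N) ℂ))))) (fun _ => rfl) hg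
      have heq := jacobianMeas_eq_of_mem hj U c hα0 hα64 hc.choose_spec (fun (V : Idx P → Matrix (Fin N) (Fin N) ℂ) (A : Matrix (Fin N) (Fin N) ℂ) => eml (fun i : Idx P => if IsCentral c i then (1 : Matrix (Fin N) (Fin N) ℂ) else V i * star A) * A) (fun _ _ => rfl) (fun p : ((Idx P → Matrix (Fin N) (Fin N) ℂ) × Matrix (Fin N) (Fin N) ℂ) × (specialUnitaryLogChart (Fin N)).lie => HaarExpChartLocal.proj (specialUnitaryLogChart (Fin N)) (mlog (star ((fun (V : Idx P → Matrix (Fin N) (Fin N) ℂ) (A : Matrix (Fin N) (Fin N) ℂ) => eml (fun i : Idx P => if IsCentral c i then (1 : Matrix (Fin N) (Fin N) ℂ) else V i * star A) * A) p.1.1 p.1.2) * (fun (V : Idx P → Matrix (Fin N) (Fin N) ℂ) (A : Matrix (Fin N) (Fin N) ℂ) => eml (fun i : Idx P => if IsCentral c i then (1 : Matrix (Fin N) (Fin N) ℂ) else V i * star A) * A) p.1.1 (p.1.2 * exp ((p.2 : (specialUnitaryLogChart (Fin N)).lie) : Matrix (Fin N) (Fin N) ℂ))))) (fun _ => rfl)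 hg
      show ENNReal.toNNReal _ ≠ 0
      rw [heq, Ne, ENNReal.toNNReal_eq_zero_iff, not_or]
      exact hne
    · rw [hjac c, dif_neg hc]; exact one_ne_zero
  · intro c U
    by_cases hc : ∃ i : Idx P, ¬ IsCentral c i
    · rw [hjac c, dif_pos hc]
      have hlaw := forwardLaw_avgFun_update_centralWindow hj U c hα0 hα24 hα64 (hgap c) hc.choose_spec (fun (V : Idx P → Matrix (Fin N) (Fin N) ℂ) (A : Matrix (Fin N) (Fin N) ℂ) => eml (fun i : Idx P => if IsCentral c i then (1 : Matrix (Fin N) (Fin N) ℂ) else V i * star A) * A) (fun _ _ => rfl) (fun p : ((Idx P → Matrix (Fin N) (Fin N) ℂ) × Matrix (Fin N) (Fin N) ℂ) × (specialUnitaryLogChart (Fin N)).lie => HaarExpChartLocal.proj (specialUnitaryLogChart (Fin N)) (mlog (star ((fun (V : Idx P → Matrix (Fin N) (Fin N) ℂ) (A : Matrix (Fin N) (Fin N) ℂ) => eml (fun i : Idx P => if IsCentral c i then (1 : Matrix (Fin N) (Fin N) ℂ) else V i * star A) * A) p.1.1 p.1.2) * (fun (V : Idx P → Matrix (Fin N)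 (Fin N) ℂ) (A : Matrix (Fin N) (Fin N) ℂ) => eml (fun i : Idx P => if IsCentral c i then (1 : Matrix (Fin N) (Fin N) ℂ) else V i * star A) * A) p.1.1 (p.1.2 * exp ((p.2 : (specialUnitaryLogChart (Fin N)).lie) : Matrix (Fin N) (Fin N) ℂ))))) (fun _ => rfl)
      rw [hlaw]
      congr 1
      refine withDensity_congr_ae ?_
      have hΩm : MeasurableSet {g : SU N | ∀ i : Idx P, dist1 (fibreFamily U c (pre U c * g * post U c) i) ≤ α} :=
        ((isClosed_centralWindowW U c α).preimage ((continuous_const.mul continuous_id).mul continuous_const)).measurableSet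
      refine (ae_restrict_iff' hΩm).2 (Filter.Eventually.of_forall fun g hg => ?_)
      have hne := jacobian_ne_zero_and_ne_top_of_mem hj U c hα0 hα24 hα64 hαL hc.choose_spec (fun (V : Idx P → Matrix (Fin N) (Fin N) ℂ) (A : Matrix (Fin N) (Fin N) ℂ) => eml (fun i : Idx P => if IsCentral c i then (1 : Matrix (Fin N) (Fin N) ℂ) else V i * star A) * A) (fun _ _ => rfl) (fun p : ((Idx P → Matrix (Fin N) (Fin N) ℂ) × Matrix (Fin N) (Fin N) ℂ) × (specialUnitaryLogChart (Fin N)).lie => HaarExpChartLocal.proj (specialUnitaryLogChart (Fin N)) (mlog (star ((fun (V : Idx P → Matrix (Fin N) (Fin N) ℂ) (A : Matrix (Fin N) (Fin N) ℂ) => eml (fun i : Idx P => if IsCentral c i then (1 : Matrix (Fin N) (Fin N) ℂ) else V i * star A) * A) p.1.1 p.1.2) * (fun (V : Idx P → Matrix (Fin N) (Fin N) ℂ) (A : Matrix (Fin N) (Fin N) ℂ) => eml (fun i : Idx P => if IsCentral c i then (1 : Matrix (Fin N) (Fin N) ℂ) else V i * star A) * A) p.1.1 (p.1.2 * exp ((p.2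 : (specialUnitaryLogChart (Fin N)).lie) : Matrix (Fin N) (Fin N) ℂ))))) (fun _ => rfl) hg
      have heq := jacobianMeas_eq_of_mem hj U c hα0 hα64 hc.choose_spec (fun (V : Idx P → Matrix (Fin N) (Fin N) ℂ) (A : Matrix (Fin N) (Fin N) ℂ) => eml (fun i : Idx P => if IsCentral c i then (1 : Matrix (Fin N) (Fin N) ℂ) else V i * star A) * A) (fun _ _ => rfl) (fun p : ((Idx P → Matrix (Fin N) (Fin N) ℂ) × Matrix (Fin N) (Fin N) ℂ) × (specialUnitaryLogChart (Fin N)).lie => HaarExpChartLocal.proj (specialUnitaryLogChart (Fin N)) (mlog (star ((fun (V : Idx P → Matrix (Fin N) (Fin N) ℂ) (A : Matrix (Fin N) (Fin N) ℂ) => eml (fun i : Idx P => if IsCentral c i then (1 : Matrix (Fin N) (Fin N) ℂ) else V i * star A) * A) p.1.1 p.1.2) * (fun (V : Idx P → Matrix (Fin N) (Fin N) ℂ) (A : Matrix (Fin N) (Fin N) ℂ) => eml (fun i : Idx P => if IsCentral c i then (1 : Matrix (Fin N) (Fin N) ℂ) else V i * star A) * A) p.1.1 (p.1.2 * exp ((p.2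 : (specialUnitaryLogChart (Fin N)).lie) : Matrix (Fin N) (Fin N) ℂ))))) (fun _ => rfl) hg
      show _ = ((ENNReal.toNNReal _ : ℝ≥0) : ℝ≥0∞)
      rw [heq, ENNReal.coe_toNNReal hne.2]
    · rw [hjac c, dif_neg hc]
      have hall : ∀ i : Idx P, IsCentral c i := fun i => by by_contra h; exact hc ⟨i, h⟩
      exact forwardLaw_of_allCentral hj U c hall hα0
  · intro c U
    by_cases hc : ∃ i : Idx P, ¬ IsCentral c i
    · rw [hjac c, dif_pos hc]
      refine (continuousOn_jacobian_toNNReal U c hα0 hα64 hc.choose_spec (fun (V : Idx P → Matrix (Fin N) (Fin N) ℂ) (A : Matrix (Fin N) (Fin N) ℂ) => eml (fun i : Idx P => if IsCentral c i then (1 : Matrix (Fin N) (Fin N) ℂ) else V i * star A) * A) (fun _ _ => rfl) (fun p : ((Idx P → Matrix (Fin N) (Fin N) ℂ) × Matrix (Fin N) (Fin N) ℂ) × (specialUnitaryLogChart (Fin N)).lie => HaarExpChartLocal.proj (specialUnitaryLogChart (Fin N)) (mlog (star ((fun (V : Idx P → Matrix (Fin N) (Fin N) ℂ) (A : Matrix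 (Fin N) (Fin N) ℂ) => eml (fun i : Idx P => if IsCentral c i then (1 : Matrix (Fin N) (Fin N) ℂ) else V i * star A) * A) p.1.1 p.1.2) * (fun (V : Idx P → Matrix (Fin N) (Fin N) ℂ) (A : Matrix (Fin N) (Fin N) ℂ) => eml (fun i : Idx P => if IsCentral c i then (1 : Matrix (Fin N) (Fin N) ℂ) else V i * star A) * A) p.1.1 (p.1.2 * exp ((p.2 : (specialUnitaryLogChart (Fin N)).lie) : Matrix (Fin N) (Fin N) ℂ))))) (fun _ => rfl)).congr fun g hg => ?_
      exact congrArg ENNReal.toNNReal (jacobianMeas_eq_of_mem hj U c hα0 hα64 hc.choose_spec (fun (V : Idx P → Matrix (Fin N) (Fin N) ℂ) (A : Matrix (Fin N) (Fin N) ℂ) => eml (fun i : Idx P => if IsCentral c i then (1 : Matrix (Fin N) (Fin N) ℂ) else V i * star A) * A) (fun _ _ => rfl) (fun p : ((Idx P → Matrix (Fin N) (Fin N) ℂ) × Matrix (Fin N) (Fin N) ℂ) × (specialUnitaryLogChart (Fin N)).lie => HaarExpChartLocal.proj (specialUnitaryLogChart (Fin N)) (mlog (star ((fun (V : Idx P →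 Matrix (Fin N) (Fin N) ℂ) (A : Matrix (Fin N) (Fin N) ℂ) => eml (fun i : Idx P => if IsCentral c i then (1 : Matrix (Fin N) (Fin N) ℂ) else V i * star A) * A) p.1.1 p.1.2) * (fun (V : Idx P → Matrix (Fin N) (Fin N) ℂ) (A : Matrix (Fin N) (Fin N) ℂ) => eml (fun i : Idx P => if IsCentral c i then (1 : Matrix (Fin N) (Fin N) ℂ) else V i * star A) * A) p.1.1 (p.1.2 * exp ((p.2 : (specialUnitaryLogChart (Fin N)).lie) : Matrix (Fin N) (Fin N) ℂ))))) (fun _ => rfl) hg)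
    · rw [hjac c, dif_neg hc]; exact continuousOn_const

/-- ★★★ **(F) DISCHARGED — THE FORWARD JACOBIAN LAWS OF THE ONE-VARIABLE (0.4) MAPS ON THE CENTRAL `α`-WINDOWS, WITH JOINTLY MEASURABLE DENSITIES POSITIVE ON THE WINDOWS, FOR
EVERY coarse bond `c` and EVERY environment `U`** (`j + 1 ≤ m + K`, `0 ≤ α ≤ 1∕24`, `64·α ≤ δ_N`, `157·α < L^{−(d−1)}`, `offCard c∕|Idx| + 150·α < 1`): exactly the inputs `(jac, hjacm, hjac0, hfwd)` of
dag-n09-w6's `…N09CentralWindowAtRecord.exists_perBondCharts_of_forwardLaws` ∕ `…N09PerBondChartsOfInjectivityWindows.exists_perBondCharts_of_injectivityWindows`.  At a bond with an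
off-central index the density is the chart Jacobian of `…N09CentralWindowForwardLaw` (one chart at `V_{i₀}`), measurable by §2 and positive by `…N09CentralWindowNondegenerate`; at an
all-central bond the map is a bi-translation and the density is `1` (§1). [cite: Balaban1987RG1, (0.4) p.253 and (2.10) p.267; Helgason2000, Ch. I §1 Thm. 1.14 (12)-(13) p. 96] -/
theorem exists_jacobian_forwardLaws (hj : j + 1 ≤ P.m + P.K) {α : ℝ} (hα0 : 0 ≤ α) (hα24 : α ≤ 1 / 24) (hα64 : 64 * α ≤ deltaSU (Fin N))
    (hαL : 157 * α < ((P.L : ℝ) ^ (P.d - 1))⁻¹) (hgap : ∀ c : PBond P (j + 1), (offCard c : ℝ) / (Fintype.card (Idx P) : ℝ) + 150 * α < 1) :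
    ∃ jac : PBond P (j + 1) → GaugeField P j (SU N) → SU N → ℝ≥0,
      (∀ c, Measurable fun p : GaugeField P j (SU N) × SU N => jac c p.1 p.2) ∧
      (∀ c U g, (∀ i : Idx P, dist1 (fibreFamily U c (pre U c * g * post U c) i) ≤ α) → jac c U g ≠ 0) ∧
      (∀ c U, (HaarData.haar : Measure (SU N)).restrict ((fun g : SU N => avgFun (expMeanLogSU (n := Fin N)) (update U (centralBond c) g) c) '' {g : SU N | ∀ i : Idx P, dist1 (fibreFamily U c (pre U c * g * post U c) i) ≤ α}) =
        Measure.map (fun g : SU N => avgFun (expMeanLogSU (n := Fin N)) (update U (centralBond c) g) c) (((HaarData.haar : Measure (SU N)).restrict {g : SU N | ∀ i : Idx P, dist1 (fibreFamily U c (pre U c * g * post U c) i) ≤ α}).withDensity fun g => (jac c U g : ℝ≥0∞))) := by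
  obtain ⟨jac, h1, h2, h3, -⟩ := exists_jacobian_forwardLaws_continuousOn (N := N) hj hα0 hα24 hα64 hαL hgap
  exact ⟨jac, h1, h2, h3⟩

end Package

/-! ## §4  At the record: dag-n09-w6's per-bond inversion data WITHOUT the forward-law hypothesis -/

section Record

variable {F : T4Family}

/-- ★★★ **AT THE RECORD: THE PER-BOND INVERSION DATA OF THE PRIVATE-COORDINATE ROAD TO `hreg`, FROM THE PROVED FORWARD LAWS** — dag-n09-w6's `exists_perBondCharts_of_forwardLaws` with its
`(jac, hjacm, hjac0, hfwd)` inputs DISCHARGED by `exists_jacobian_forwardLaws` (`j < K`, `0 ≤ α ≤ 1∕24`, `64·α ≤ δ_N`, `157·α < L^{−(d−1)}` on `F.P K`, `offCard∕|Idx| + 150·α < 1`):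
image windows, ONE jointly measurable two-sided inverse `ϑ`, the inverse law with density `jd`, and the pointwise facts — every per-bond hypothesis of
`…N09HregOfPerBondChartsAtRecord.hreg_of_perBondCharts` at level `j` except the support clause (dag-n09-w5) and the continuity `hgc`.
[cite: Balaban1987RG1, p.259, (0.4) p.253, (2.9)–(2.10) pp.266–267; Kechris1995, Thm 15.1 and Cor 15.2; Helgason2000, Ch. I §1 Thm. 1.14 (12)-(13) p. 96] -/
theorem exists_perBondCharts_centralWindow {K : ℕ} (hj : j < K) {α : ℝ} (hα0 : 0 ≤ α) (hα24 : α ≤ 1 / 24) (hα64 : 64 * α ≤ deltaSU (Fin N))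
    (hαL : 157 * α < (((F.P K).L : ℝ) ^ ((F.P K).d - 1))⁻¹)
    (hgap : ∀ c : PBond (F.P K) (j + 1), (offCard c : ℝ) / (Fintype.card (Idx (F.P K)) : ℝ) + 150 * α < 1) :
    ∃ (T : PBond (F.P K) (j + 1) → GaugeField (F.P K) j (SU N) → Set (SU N))
      (ϑ : PBond (F.P K) (j + 1) → GaugeField (F.P K) j (SU N) → SU N → SU N)
      (jd : PBond (F.P K) (j + 1) → GaugeField (F.P K) j (SU N) → SU N → ℝ≥0),
      (∀ c, MeasurableSet {p : GaugeField (F.P K) j (SU N) × SU N | p.2 ∈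
          {g : SU N | ∀ i : Idx (F.P K), dist1 (fibreFamily p.1 c (pre p.1 c * g * post p.1 c) i) ≤ α}}) ∧
      (∀ c (U : GaugeField (F.P K) j (SU N)) (g' : PBond (F.P K) (j + 1) → SU N),
          {g : SU N | ∀ i : Idx (F.P K), dist1 (fibreFamily (extend centralBond g' U) c
              (pre (extend centralBond g' U) c * g * post (extend centralBond g' U) c) i) ≤ α} =
            {g : SU N | ∀ i : Idx (F.P K), dist1 (fibreFamily U c (pre U c * g * post U c) i) ≤ α}) ∧
      (∀ c, MeasurableSet {p : GaugeField (F.P K) j (SU N) × SU N | p.2 ∈ T c p.1}) ∧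
      (∀ c, Measurable fun p : GaugeField (F.P K) j (SU N) × SU N => ϑ c p.1 p.2) ∧
      (∀ c, Measurable fun p : GaugeField (F.P K) j (SU N) × SU N => jd c p.1 p.2) ∧
      (∀ c U, ∀ v ∈ T c U, (avOfRecord F N K j).avg (Function.update U (centralBond c) (ϑ c U v)) c = v) ∧
      (∀ c U, (HaarData.haar : Measure (SU N)).restrict {g : SU N | ∀ i : Idx (F.P K), dist1 (fibreFamily U c (pre U c * g * post U c) i) ≤ α} =
        (((HaarData.haar : Measure (SU N)).restrict (T c U)).withDensity fun v => (jd c U v : ℝ≥0∞)).map (ϑ c U)) ∧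
      (∀ c U, T c U = (fun g => (avOfRecord F N K j).avg (Function.update U (centralBond c) g) c) ''
          {g : SU N | ∀ i : Idx (F.P K), dist1 (fibreFamily U c (pre U c * g * post U c) i) ≤ α}) ∧
      (∀ c U g, (∀ i : Idx (F.P K), dist1 (fibreFamily U c (pre U c * g * post U c) i) ≤ α) →
          ϑ c U ((avOfRecord F N K j).avg (Function.update U (centralBond c) g) c) = g) ∧
      (∀ c U, ∀ v ∈ T c U, ∀ i : Idx (F.P K), dist1 (fibreFamily U c (pre U c * ϑ c U v * post U c) i) ≤ α) := by
  have hαδ : α < deltaSU (Fin N) := by have := ExpMeanLog.deltaSU_pos (n := Fin N); linarith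
  obtain ⟨jac, hjacm, hjac0, hfwd⟩ := exists_jacobian_forwardLaws (N := N) (succ_le_range_of_lt hj) hα0 hα24 hα64 hαL hgap
  exact exists_perBondCharts_of_forwardLaws hj hα0 hα24 hαδ hgap jac hjacm hjac0 hfwd

end Record

end Summit.QuantumFields.YangMills.BalabanUVNodes.N09CentralWindowForwardLawAtRecord
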